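import Mathlib
import Summits.CriticalPhenomena.Ising3DConformalLimit.Theorems.HyperoctahedralRPNullConeLocalRigidityRoots

/-!
# Null-cone local rigidity — the diagonal fibre

Helper file for item `stmt-CriticalPhenomena-4275`
(`Summit.CriticalPhenomena.Ising3DConformalLimit.Theses.HyperoctahedralRP.NullConeLocalRigidity`).

We work in the rotated coordinates `y₀ = x₀ + x₁`, `y₁ = x₀ - x₁`, `y₂ = x₂`, in which the
diagonal-mirror fibre `(a + t, -a + t, b)` of the item is the `y₀`-axis direction
`(2t, 2a, b)` and `2 (x·x) = y₀² + y₁² + 2 y₂²`.  For a polynomial `Q` in the `y`-variables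
which is even in `y₀` (coefficient-wise) and of total degree `≤ 2m`:

* `aeval_cons_eq_aeval_map_finSuccEquiv`: the fibre polynomial is
  `f = (finSuccEquiv Q).map (eval v)`, `v = (2a, b)`;
* `fibre`: `f = g(Y²)` and with `q(u) = g(u - c)`, `c = 4a² + 2b²`, the root test
  "all roots `y₀` of `(y₀² + c)^m + ε f(y₀)` are purely imaginary" becomes
  "all complex roots of `u^m + ε q(u)` are real", while `q(0) = Q(i√c, 2a, b)` is the value of
  `Q` at a complex NULL vector;
* `aeval_nullPoint_eq_zero` (`m ≥ 3`) and `eventually_mul_nullValue_le` (`m ≥ 2`) then follow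
  from the univariate core (`…NullConeLocalRigidityRoots`);
* `coeff_eq_zero_of_odd` turns sign-flip invariance into vanishing of odd coefficients, and
  `rootTest_transfer` moves the item's hypothesis to the `y`-coordinates.
-/

noncomputable section

open Filter Topology MvPolynomial

namespace Summit.CriticalPhenomena.Ising3DConformalLimit.Theorems.NullConeLocalRigidity

/-! ### Sign-flip invariance, coefficient-wise -/

/-- The sign flip `X i ↦ -X i` multiplies the monomial `x^d` by `(-1)^{d i}`. -/
theorem aeval_negVar_monomial {σ : Type*} [DecidableEq σ] (i : σ) (d : σ →₀ ℕ) (c : ℝ) :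
    MvPolynomial.aeval (fun j : σ => if j = i then -(X j : MvPolynomial σ ℝ) else X j)
        (monomial d c) = monomial d ((-1) ^ (d i) * c) := by
  rw [MvPolynomial.aeval_monomial, Finsupp.prod]
  have h1 : ∀ j ∈ d.support, (if j = i then -(X j : MvPolynomial σ ℝ) else X j) ^ (d j)
      = MvPolynomial.C ((if j = i then (-1 : ℝ) else 1) ^ (d j)) * X j ^ (d j) := by
    intro j _
    split_ifs
    · rw [map_pow, ← mul_pow]; simp
    · simp
  rw [Finset.prod_congr rfl h1, Finset.prod_mul_distrib, ← map_prod]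
  have h2 : ∏ j ∈ d.support, (if j = i then (-1 : ℝ) else 1) ^ (d j) = (-1) ^ (d i) := by
    rw [Finset.prod_eq_single i]
    · simp
    · intro j _ hj; simp [hj]
    · intro hi
      rw [Finsupp.notMem_support_iff.1 hi]
      simp
  rw [h2, monomial_eq, Finsupp.prod]
  simp only [algebraMap_eq, ← map_mul, ← mul_assoc]
  congr 2
  ring

/-- Coefficients of the sign-flipped polynomial. -/
theorem coeff_aeval_negVar {σ : Type*} [DecidableEq σ] (i : σ) (P : MvPolynomial σ ℝ)
    (d : σ →₀ ℕ) :
    coeff d (MvPolynomial.aeval (fun j : σ => if j = i then -(X j : MvPolynomial σ ℝ) else X j) P)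
      = (-1) ^ (d i) * coeff d P := by
  induction P using MvPolynomial.induction_on' with
  | monomial e c =>
    rw [aeval_negVar_monomial, MvPolynomial.coeff_monomial, MvPolynomial.coeff_monomial]
    split_ifs with h
    · rw [h]
    · simp
  | add p q hp hq => rw [map_add, MvPolynomial.coeff_add, MvPolynomial.coeff_add, hp, hq, mul_add]

/-- A polynomial invariant under `X i ↦ -X i` has no monomial of odd degree in `X i`. -/
theorem coeff_eq_zero_of_odd {σ : Type*} [DecidableEq σ] (i : σ) (P : MvPolynomial σ ℝ)
    (h : MvPolynomial.aeval (fun j : σ => if j = i then -(X j : MvPolynomial σ ℝ) else X j) P = P)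
    (d : σ →₀ ℕ) (hd : Odd (d i)) : coeff d P = 0 := by
  have h1 := coeff_aeval_negVar i P d
  rw [h, hd.neg_one_pow] at h1
  linarith

/-! ### The fibre polynomial -/

/-- Evaluating at `(y, v₁, …, vₙ)` with real `v` and complex `y` is evaluating the
`finSuccEquiv`-polynomial, with coefficients specialised at `v`, at `y`. -/
theorem aeval_cons_eq_aeval_map_finSuccEquiv {n : ℕ} (v : Fin n → ℝ) (y : ℂ)
    (P : MvPolynomial (Fin (n + 1)) ℝ) :
    MvPolynomial.aeval (Fin.cons y (fun j => (v j : ℂ)) : Fin (n + 1) → ℂ) P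
      = Polynomial.aeval y ((finSuccEquiv ℝ n P).map (MvPolynomial.eval v)) := by
  have key : (MvPolynomial.aeval (Fin.cons y (fun j => (v j : ℂ)) : Fin (n + 1) → ℂ)) =
      (Polynomial.aeval y).comp ((Polynomial.mapAlgHom (MvPolynomial.aeval v)).comp
        (finSuccEquiv ℝ n).toAlgHom) := by
    apply MvPolynomial.algHom_ext
    intro i
    refine Fin.cases ?_ (fun j => ?_) i
    · simp [finSuccEquiv_X_zero]
    · simp [finSuccEquiv_X_succ]
  have := congrArg (fun φ => φ P) key
  simpa [Polynomial.coe_mapAlgHom, MvPolynomial.coe_aeval_eq_eval] using this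

/-- Value of `y₀² + y₁² + 2 y₂²` on the fibre. -/
theorem aeval_cons_quad (v : Fin 2 → ℝ) (y : ℂ) :
    MvPolynomial.aeval (Fin.cons y (fun j => (v j : ℂ)) : Fin 3 → ℂ)
      ((X 0 : MvPolynomial (Fin 3) ℝ) ^ 2 + X 1 ^ 2 + 2 * X 2 ^ 2)
      = y ^ 2 + ((v 0 ^ 2 + 2 * v 1 ^ 2 : ℝ) : ℂ) := by
  have h1 : (Fin.cons y (fun j => (v j : ℂ)) : Fin 3 → ℂ) 1 = v 0 := rfl
  have h2 : (Fin.cons y (fun j => (v j : ℂ)) : Fin 3 → ℂ) 2 = v 1 := rfl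
  simp only [map_add, map_mul, map_pow, map_ofNat, MvPolynomial.aeval_X, Fin.cons_zero, h1, h2]
  push_cast
  ring

/-- **The fibre lemma.** For `Q` even in `y₀` (coefficient-wise) with `totalDegree Q ≤ 2m` and
real `v = (v₀, v₁)`, there is `q ∈ ℝ[u]` with `deg q ≤ m`, `q(0) = Q(i√c, v₀, v₁)`
(`c = v₀² + 2 v₁²`, a complex null vector of `y₀² + y₁² + 2y₂²`), and such that for every real
`ε`: if all roots `y₀` of `(y₀² + c)^m + ε Q(y₀, v)` are purely imaginary then all complex roots
of `u^m + ε q(u)` are real. -/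
theorem fibre {m : ℕ} (Q : MvPolynomial (Fin 3) ℝ) (hQdeg : Q.totalDegree ≤ 2 * m)
    (heven : ∀ d : Fin 3 →₀ ℕ, Odd (d 0) → coeff d Q = 0) (v : Fin 2 → ℝ) :
    ∃ q : Polynomial ℝ, q.natDegree ≤ m ∧
      ((q.coeff 0 : ℝ) : ℂ) = MvPolynomial.aeval
        (Fin.cons (Complex.I * Real.sqrt (v 0 ^ 2 + 2 * v 1 ^ 2)) (fun j => (v j : ℂ)) :
          Fin 3 → ℂ) Q ∧
      ∀ e : ℝ, (∀ y : ℂ, MvPolynomial.aeval (Fin.cons y (fun j => (v j : ℂ)) : Fin 3 → ℂ)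
            (((X 0 : MvPolynomial (Fin 3) ℝ) ^ 2 + X 1 ^ 2 + 2 * X 2 ^ 2) ^ m
              + MvPolynomial.C e * Q) = 0 → y.re = 0) →
        ∀ u : ℂ, Polynomial.aeval u ((Polynomial.X : Polynomial ℝ) ^ m + Polynomial.C e * q) = 0 →
          u.im = 0 := by
  set c := v 0 ^ 2 + 2 * v 1 ^ 2 with hc
  have hc0 : 0 ≤ c := by positivity
  set f : Polynomial ℝ := (finSuccEquiv ℝ 2 Q).map (MvPolynomial.eval v) with hf
  -- odd coefficients of `f` vanish
  have hfodd : ∀ k, Odd k → f.coeff k = 0 := by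
    intro k hk
    rw [hf, Polynomial.coeff_map]
    have : (finSuccEquiv ℝ 2 Q).coeff k = 0 := by
      ext d
      rw [finSuccEquiv_coeff_coeff, MvPolynomial.coeff_zero]
      exact heven _ (by simpa using hk)
    rw [this, map_zero]
  set g := Polynomial.contract 2 f with hg
  have hfg : Polynomial.expand ℝ 2 g = f := by
    ext k
    rw [Polynomial.coeff_expand two_pos, hg]
    split_ifs with h
    · rw [Polynomial.coeff_contract two_ne_zero, Nat.div_mul_cancel h]
    · exact (hfodd k (Nat.odd_iff.2 (by omega))).symm
  -- degrees
  have hfdeg : f.natDegree ≤ 2 * m := by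
    calc f.natDegree ≤ (finSuccEquiv ℝ 2 Q).natDegree := Polynomial.natDegree_map_le
      _ = degreeOf 0 Q := natDegree_finSuccEquiv Q
      _ ≤ Q.totalDegree := degreeOf_le_totalDegree Q 0
      _ ≤ 2 * m := hQdeg
  have hgdeg : g.natDegree ≤ m := by
    have := Polynomial.natDegree_expand 2 g
    rw [hfg] at this
    omega
  set q := g.comp (Polynomial.X - Polynomial.C c) with hq
  have hqdeg : q.natDegree ≤ m := by
    calc q.natDegree ≤ g.natDegree * (Polynomial.X - Polynomial.C c).natDegree :=
          Polynomial.natDegree_comp_le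
      _ ≤ m := by rw [Polynomial.natDegree_X_sub_C, mul_one]; exact hgdeg
  refine ⟨q, hqdeg, ?_, ?_⟩
  · have h1 : q.coeff 0 = g.eval (-c) := by
      rw [Polynomial.coeff_zero_eq_eval_zero, hq, Polynomial.eval_comp]
      simp
    have hsq : (Complex.I * Real.sqrt c) ^ 2 = algebraMap ℝ ℂ (-c) := by
      rw [mul_pow, Complex.I_sq, ← Complex.ofReal_pow, Real.sq_sqrt hc0]
      simp
    rw [h1, aeval_cons_eq_aeval_map_finSuccEquiv, ← hf, ← hfg, Polynomial.expand_aeval, hsq,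
      Polynomial.aeval_algebraMap_apply_eq_algebraMap_eval]
    rfl
  · intro e he u hu
    obtain ⟨y, hy⟩ := IsAlgClosed.exists_pow_nat_eq (u - (c : ℂ)) two_pos
    have hyf : Polynomial.aeval y f = Polynomial.aeval (u - c) g := by
      rw [← hfg, Polynomial.expand_aeval, hy]
    have hval : MvPolynomial.aeval (Fin.cons y (fun j => (v j : ℂ)) : Fin 3 → ℂ)
        (((X 0 : MvPolynomial (Fin 3) ℝ) ^ 2 + X 1 ^ 2 + 2 * X 2 ^ 2) ^ m
          + MvPolynomial.C e * Q) = u ^ m + e * Polynomial.aeval (u - c) g := by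
      rw [map_add, map_pow, aeval_cons_quad, map_mul, MvPolynomial.aeval_C,
        aeval_cons_eq_aeval_map_finSuccEquiv, ← hf, hyf, hy]
      simp [hc]
    have hu' : u ^ m + e * Polynomial.aeval (u - c) g = 0 := by
      rw [hq] at hu
      simpa [Polynomial.aeval_comp] using hu
    have hyre : y.re = 0 := he y (by rw [hval, hu'])
    have hu_eq : u = y ^ 2 + c := by rw [hy]; ring
    rw [hu_eq, Complex.add_im, Complex.ofReal_im, add_zero]
    simp [sq, hyre]

/-- **Null value vanishes (`m ≥ 3`).** If the rotated pencil passes the root test on the fibre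
`v` along `ε_n → 0`, `ε_n ≠ 0`, then `Q` vanishes at the null vector `(i√(v₀²+2v₁²), v₀, v₁)`. -/
theorem aeval_nullPoint_eq_zero {m : ℕ} (hm : 3 ≤ m) (Q : MvPolynomial (Fin 3) ℝ)
    (hQdeg : Q.totalDegree ≤ 2 * m) (heven : ∀ d : Fin 3 →₀ ℕ, Odd (d 0) → coeff d Q = 0)
    (ε : ℕ → ℝ) (hε : Tendsto ε atTop (𝓝[≠] 0)) (v : Fin 2 → ℝ)
    (hroot : ∀ (n : ℕ) (y : ℂ), MvPolynomial.aeval (Fin.cons y (fun j => (v j : ℂ)) : Fin 3 → ℂ)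
        (((X 0 : MvPolynomial (Fin 3) ℝ) ^ 2 + X 1 ^ 2 + 2 * X 2 ^ 2) ^ m
          + MvPolynomial.C (ε n) * Q) = 0 → y.re = 0) :
    MvPolynomial.aeval
        (Fin.cons (Complex.I * Real.sqrt (v 0 ^ 2 + 2 * v 1 ^ 2)) (fun j => (v j : ℂ)) :
          Fin 3 → ℂ) Q = 0 := by
  obtain ⟨q, hqdeg, hq0, hreal⟩ := fibre Q hQdeg heven v
  rw [← hq0, coeff_zero_eq_zero_of_realRooted hm q hqdeg ε hε (fun n => hreal (ε n) (hroot n))]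
  simp

/-- **Sign condition (`m ≥ 2`).** The null value `w = Q(i√c, v)` is real and eventually
`ε_n w' ≤ K ε_n²`, where `w'` is the `(m-2)`-nd Taylor coefficient; for `m = 2`, `w' = w`. We
record the `m = 2` case. -/
theorem eventually_mul_nullValue_le (Q : MvPolynomial (Fin 3) ℝ)
    (hQdeg : Q.totalDegree ≤ 2 * 2) (heven : ∀ d : Fin 3 →₀ ℕ, Odd (d 0) → coeff d Q = 0)
    (ε : ℕ → ℝ) (hε : Tendsto ε atTop (𝓝[≠] 0)) (v : Fin 2 → ℝ)
    (hroot : ∀ (n : ℕ) (y : ℂ), MvPolynomial.aeval (Fin.cons y (fun j => (v j : ℂ)) : Fin 3 → ℂ)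
        (((X 0 : MvPolynomial (Fin 3) ℝ) ^ 2 + X 1 ^ 2 + 2 * X 2 ^ 2) ^ 2
          + MvPolynomial.C (ε n) * Q) = 0 → y.re = 0) :
    ∃ w K : ℝ, MvPolynomial.aeval
        (Fin.cons (Complex.I * Real.sqrt (v 0 ^ 2 + 2 * v 1 ^ 2)) (fun j => (v j : ℂ)) :
          Fin 3 → ℂ) Q = w ∧ ∀ᶠ n in atTop, ε n * w ≤ K * (ε n) ^ 2 := by
  obtain ⟨q, hqdeg, hq0, hreal⟩ := fibre Q hQdeg heven v
  refine ⟨q.coeff 0, (q.coeff 1) ^ 2, hq0.symm, ?_⟩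
  have := eventually_mul_coeff_le_of_realRooted (le_refl 2) q hqdeg ε hε
    (fun n => hreal (ε n) (hroot n))
  simpa using this

/-! ### Transfer of the item's hypothesis to the rotated coordinates -/

/-- The rotated root test: with `y₀ = x₀ + x₁ = 2t`, `y₁ = x₀ - x₁ = 2a`, `y₂ = x₂ = b`, the
item's hypothesis on the fibre `(a + t, -a + t, b)` for the pencil `(x·x)^m + ε Q` is the root
test on the fibre `(y₀, 2a, b)` for `(y₀² + y₁² + 2y₂²)^m + ε · 2^m Q((y₀+y₁)/2, (y₀-y₁)/2, y₂)`. -/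
theorem rootTest_transfer {m : ℕ} (Q : MvPolynomial (Fin 3) ℝ) (e a b : ℝ)
    (h : ∀ t : ℂ, MvPolynomial.eval₂ (algebraMap ℝ ℂ) ![(a : ℂ) + t, -(a : ℂ) + t, (b : ℂ)]
      ((MvPolynomial.X 0 ^ 2 + MvPolynomial.X 1 ^ 2 + MvPolynomial.X 2 ^ 2) ^ m
        + MvPolynomial.C e * Q) = 0 → t.re = 0) :
    ∀ y : ℂ, MvPolynomial.aeval (Fin.cons y (fun j => ((![2 * a, b] : Fin 2 → ℝ) j : ℂ)) :
          Fin 3 → ℂ)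
        (((X 0 : MvPolynomial (Fin 3) ℝ) ^ 2 + X 1 ^ 2 + 2 * X 2 ^ 2) ^ m
          + MvPolynomial.C e * (MvPolynomial.C ((2 : ℝ) ^ m) * MvPolynomial.aeval
            ![MvPolynomial.C (1 / 2 : ℝ) * (X 0 + X 1), MvPolynomial.C (1 / 2 : ℝ) * (X 0 - X 1),
              (X 2 : MvPolynomial (Fin 3) ℝ)] Q)) = 0 → y.re = 0 := by
  intro y hy
  set w : Fin 3 → ℂ := Fin.cons y (fun j => ((![2 * a, b] : Fin 2 → ℝ) j : ℂ)) with hw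
  have hw0 : w 0 = y := rfl
  have hw1 : w 1 = ((2 * a : ℝ) : ℂ) := rfl
  have hw2 : w 2 = ((b : ℝ) : ℂ) := rfl
  have hpt : ∀ P : MvPolynomial (Fin 3) ℝ, MvPolynomial.aeval w (MvPolynomial.aeval
      ![MvPolynomial.C (1 / 2 : ℝ) * (X 0 + X 1), MvPolynomial.C (1 / 2 : ℝ) * (X 0 - X 1),
        (X 2 : MvPolynomial (Fin 3) ℝ)] P)
      = MvPolynomial.aeval ![(a : ℂ) + y / 2, -(a : ℂ) + y / 2, (b : ℂ)] P := by
    intro P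
    rw [MvPolynomial.comp_aeval_apply]
    have hfun : (fun i => MvPolynomial.aeval w
        (![MvPolynomial.C (1 / 2 : ℝ) * (X 0 + X 1), MvPolynomial.C (1 / 2 : ℝ) * (X 0 - X 1),
          (X 2 : MvPolynomial (Fin 3) ℝ)] i)) = ![(a : ℂ) + y / 2, -(a : ℂ) + y / 2, (b : ℂ)] := by
      funext i
      fin_cases i
      · simp [hw0, hw1]; ring
      · simp [hw0, hw1]; ring
      · simp [hw2]
    rw [hfun]
  have h1 : MvPolynomial.aeval w
      (((X 0 : MvPolynomial (Fin 3) ℝ) ^ 2 + X 1 ^ 2 + 2 * X 2 ^ 2) ^ m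
        + MvPolynomial.C e * (MvPolynomial.C ((2 : ℝ) ^ m) * MvPolynomial.aeval
          ![MvPolynomial.C (1 / 2 : ℝ) * (X 0 + X 1), MvPolynomial.C (1 / 2 : ℝ) * (X 0 - X 1),
            (X 2 : MvPolynomial (Fin 3) ℝ)] Q))
      = (2 : ℂ) ^ m * MvPolynomial.aeval ![(a : ℂ) + y / 2, -(a : ℂ) + y / 2, (b : ℂ)]
          ((MvPolynomial.X 0 ^ 2 + MvPolynomial.X 1 ^ 2 + MvPolynomial.X 2 ^ 2) ^ m
            + MvPolynomial.C e * Q) := by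
    rw [map_add, map_mul, map_mul, MvPolynomial.aeval_C, MvPolynomial.aeval_C, hpt Q]
    simp only [map_add, map_mul, map_pow, map_ofNat, MvPolynomial.aeval_X, MvPolynomial.aeval_C,
      hw0, hw1, hw2, Matrix.cons_val_zero, Matrix.cons_val_one, Matrix.cons_val_two,
      Matrix.head_cons, Matrix.tail_cons, Complex.coe_algebraMap]
    push_cast
    have h2 : ((a : ℂ) + y / 2) ^ 2 + (-(a : ℂ) + y / 2) ^ 2 + (b : ℂ) ^ 2
        = (y ^ 2 + (2 * a) ^ 2 + 2 * b ^ 2) / 2 := by ring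
    rw [h2, div_pow, mul_add, mul_div_cancel₀ _ (pow_ne_zero _ two_ne_zero)]
    ring
  rw [h1] at hy
  have hy' := (mul_eq_zero.1 hy).resolve_left (pow_ne_zero _ two_ne_zero)
  have := h (y / 2) (by rwa [← MvPolynomial.aeval_def])
  simpa using this

end Summit.CriticalPhenomena.Ising3DConformalLimit.Theorems.NullConeLocalRigidity

end
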